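import Literature.NumberTheory.GaloisRepresentations.HomDualPresentation
import Literature.NumberTheory.GaloisRepresentations.HomPermutationModuleVanishing
import HarnessLib

/-!
# The readout is onto LOCALLY: restricting a permutation presentation along `Γ_{K'} → Γ_K` keeps uniform
# isotropy (with the local layer `K'(ι L)`), so every class of `H¹(K', Hom(N, K̄'ˣ))` is `δ₀ h`

Topic `NumberTheory/GaloisRepresentations`; namespace `Literature.NumberTheory.GaloisRepresentations.HomDual`.
Definitions with bodies (`localLayer`, `resAction`, `restrictIntertwining`) and theorems; no named fact, no
instance (the `MulAction` of `Γ_{K'}` on `β` is a `def`, installed with `letI`), no `sorry`.  Sequel to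
`HomDualPresentation` (door-c6 g16: `dualδ₀`, `dualδ₀_surjective`) and `HomPermutationModuleVanishing`
(door-c6 g16: `UniformIsotropy`, `PermutedBasis`, `galoisCohomology_hom_units_eq_zero`).

THE MATHEMATICS (Milne ADT I Lemma 4.13, the local factor, on the "presentation road").  Let `K'/K` be
fields (intended: `K' = K_v` a completion of the number field `K`), `ι : K̄ → K̄'` the tree's chosen
embedding with `res : Γ_{K'} → Γ_K` (`absClosureEmbedding`, `absGaloisRestrict`).  For a finite Galois
`L ⊆ K̄` the LOCAL LAYER `K'(ι L) ⊆ K̄'` (`localLayer`) has `Gal(K̄'/K'(ιL)) = res⁻¹(Gal(K̄/L))`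
(`comap_absGaloisRestrict_eq`).  Hence a `Γ_K`-set `β` with uniform isotropy `Γ_L` restricts to a
`Γ_{K'}`-set with uniform isotropy `Γ_{K'(ιL)}` (`uniformIsotropy_restrict`), a permuted basis stays permuted
(`permutedBasis_restrict`), a short exact sequence of discrete `Γ_K`-modules restricts to one of
`Γ_{K'}`-modules (`isSES_restrict`), and therefore (char. 0, `K'(ιL)/K'` finite normal):
**`dualδ₀_units_restrict_surjective`** — for a presentation `0 → N₁ → P → N → 0` over `K` with `P` a
permutation module of uniform open isotropy, EVERY class of `H¹(K', Hom(N, K̄'ˣ))` is the readout `δ₀ h` of a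
`Γ_{K'}`-equivariant homomorphism `h : N₁ → K̄'ˣ`.

USE: at a place `v` of a number field (`K' = K_v`; for finite `v` the local layer is the tree's
`SemiLocal.compositum`, Galois by `SemiLocal.isGalois_compositum`) this is the local half of hypothesis (R3) of
`middleExact_allPlaces_of_readout` (Summits, door-c6 g16) for door-c4's free presentation of `M^D`.
HONEST FRAMING: no case of Poitou–Tate or BSD is proved here.

## References
* J. S. Milne, *Arithmetic Duality Theorems* (2nd ed. 2006), I Lemma 4.13 (proof: the factor at `v ∈ T`).
  [MilneADT2006]
* J.-P. Serre, *Local Fields*, GTM 67 (1979), X §1 Prop. 2. [SerreLocalFields1979]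
* J. W. S. Cassels, A. Fröhlich (eds.), *Algebraic Number Theory* (1967), Ch. II §10 (`L_w = K_v L`).
  [CasselsFrohlichANT1967]
-/

noncomputable section

namespace Literature.NumberTheory.GaloisRepresentations

namespace HomDual

open Literature.Algebra.Homology Literature.Algebra.Homology.DiscreteRep ContRepresentation Field
  HomPermutation DiscreteGaloisModule

variable (K : Type) [Field K] (K' : Type) [Field K'] [Algebra K K']

/-! ## §1 The local layer `K'(ι L)` and its absolute Galois group `res⁻¹(Γ_L)` -/

/-- **The local layer `K'(ι L) ⊆ K̄'`** generated over `K'` by the image of `L ⊆ K̄` under the chosen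
embedding `ι : K̄ → K̄'` (Cassels–Fröhlich's compositum `L_w = K_v L`; for a finite place of a number field this
is the tree's `SemiLocal.compositum`). [cite: CasselsFrohlichANT1967, Ch. II §10] -/
def localLayer (L : IntermediateField K (AlgebraicClosure K)) : IntermediateField K' (AlgebraicClosure K') :=
  IntermediateField.adjoin K' (Set.range fun x : L => absClosureEmbedding K K' (x : AlgebraicClosure K))

/-- **`Gal(K̄'/K'(ιL)) = res⁻¹(Gal(K̄/L))`**: an automorphism of `K̄'/K'` fixes `K'(ιL)` iff its restriction
to `K̄` fixes `L` (`ι (res σ • x) = σ • ι x`). [cite: CasselsFrohlichANT1967, Ch. II §10] -/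
theorem comap_absGaloisRestrict_eq (L : IntermediateField K (AlgebraicClosure K)) [Normal K L]
    [Normal K' (localLayer K K' L)] :
    (absGaloisFixingSubgroup L).comap ((absGaloisRestrict K K' : absoluteGaloisGroup K' →ₜ* absoluteGaloisGroup K) :
      absoluteGaloisGroup K' →* absoluteGaloisGroup K) = absGaloisFixingSubgroup (localLayer K K' L) := by
  ext σ
  rw [Subgroup.mem_comap, mem_absGaloisFixingSubgroup_iff, mem_absGaloisFixingSubgroup_iff, localLayer,
    IntermediateField.forall_mem_adjoin_smul_eq_self_iff]
  constructor
  · rintro h _ ⟨x, rfl⟩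
    have hx := h x x.2
    change absGaloisRestrict K K' σ • (x : AlgebraicClosure K) = x at hx
    rw [← absGaloisRestrict_apply_smul, hx]
  · intro h x hx
    apply (absClosureEmbedding K K').toRingHom.injective
    change absClosureEmbedding K K' (absGaloisRestrict K K' σ • x) = absClosureEmbedding K K' x
    rw [absGaloisRestrict_apply_smul]
    exact h _ ⟨⟨x, hx⟩, rfl⟩

/-! ## §2 Restricting the permutation structure and the short exact sequence along `Γ_{K'} → Γ_K` -/

/-- The `Γ_{K'}`-set structure on a `Γ_K`-set `β` through `res : Γ_{K'} → Γ_K` (a definition, installed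
locally with `letI`). [cite: MilneADT2006, I Lemma 4.13 (proof)] -/
@[reducible]
def resAction (β : Type) [MulAction (absoluteGaloisGroup K) β] : MulAction (absoluteGaloisGroup K') β :=
  MulAction.compHom β ((absGaloisRestrict K K' : absoluteGaloisGroup K' →ₜ* absoluteGaloisGroup K) :
    absoluteGaloisGroup K' →* absoluteGaloisGroup K)

variable {K K'}
variable {β : Type} [MulAction (absoluteGaloisGroup K) β] {L : IntermediateField K (AlgebraicClosure K)} [Normal K L]

omit [Normal K L] in
/-- `σ • b = res σ • b` for the restricted action. [cite: MilneADT2006, I Lemma 4.13 (proof)] -/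
theorem resAction_smul (σ : absoluteGaloisGroup K') (b : β) :
    (letI := resAction K K' β; σ • b) = absGaloisRestrict K K' σ • b := rfl

/-- **Uniform isotropy restricts**: if every isotropy group of `Γ_K` on `β` is `Γ_L`, every isotropy group of
`Γ_{K'}` on `β` is `Γ_{K'(ιL)}`. [cite: MilneADT2006, I Lemma 4.13 (proof)] -/
theorem uniformIsotropy_restrict [Normal K' (localLayer K K' L)] (hstab : UniformIsotropy K β L) :
    letI := resAction K K' β; UniformIsotropy K' β (localLayer K K' L) := by
  letI := resAction K K' β
  intro b
  rw [← comap_absGaloisRestrict_eq K K' L, ← hstab b]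
  ext σ
  rw [MulAction.mem_stabilizer_iff, Subgroup.mem_comap, MulAction.mem_stabilizer_iff]
  rfl

variable {VP : Type} [AddCommGroup VP] [TopologicalSpace VP] [DiscreteTopology VP]
  {ρP : DiscreteGaloisModule K VP} {e : Module.Basis β ℤ VP}

omit [Normal K L] in
/-- **A permuted basis stays permuted** for the restricted structures. [cite: MilneADT2006, I Lemma 4.13 (proof)] -/
theorem permutedBasis_restrict (he : PermutedBasis K ρP e) :
    letI := resAction K K' β; PermutedBasis K' (ρP.restrictField K') e := by
  intro γ i
  rw [GaloisRep.restrictField_apply]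
  exact he _ i

variable {X Y : Type} [AddCommGroup X] [TopologicalSpace X] [DiscreteTopology X]
  [AddCommGroup Y] [TopologicalSpace Y] [DiscreteTopology Y]
  (ρX : DiscreteGaloisModule K X) (ρY : DiscreteGaloisModule K Y)

/-- An equivariant map restricts to an equivariant map of the restricted modules (same underlying map).
[cite: MilneADT2006, I Lemma 4.13 (proof)] -/
def restrictIntertwining (u : ρX.toContRepresentation →ⁱL ρY.toContRepresentation) :
    (ρX.restrictField K').toContRepresentation →ⁱL (ρY.restrictField K').toContRepresentation where
  toContinuousLinearMap := u.toContinuousLinearMap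
  isIntertwining' σ := by
    refine ContinuousLinearMap.ext fun x => ?_
    simpa [ContinuousRep.toContRepresentation_apply_apply, GaloisRep.restrictField_apply] using
      congr($(u.isIntertwining' (absGaloisRestrict K K' σ)) x)

omit [Normal K L] in
/-- Unfolding. [cite: MilneADT2006, I Lemma 4.13 (proof)] -/
@[simp] theorem restrictIntertwining_apply (u : ρX.toContRepresentation →ⁱL ρY.toContRepresentation) (x : X) :
    restrictIntertwining (K' := K') ρX ρY u x = u x := rfl

variable {Z : Type} [AddCommGroup Z] [TopologicalSpace Z] [DiscreteTopology Z] (ρZ : DiscreteGaloisModule K Z)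

omit [Normal K L] in
/-- **A short exact sequence of discrete `Γ_K`-modules restricts to one of `Γ_{K'}`-modules** (same maps).
[cite: MilneADT2006, I Lemma 4.13 (proof)] -/
theorem isSES_restrict {i : ρX.toContRepresentation →ⁱL ρY.toContRepresentation}
    {p : ρY.toContRepresentation →ⁱL ρZ.toContRepresentation}
    (hS : IsSES (toTopRepHom ρX ρY i) (toTopRepHom ρY ρZ p)) :
    IsSES (toTopRepHom (ρX.restrictField K') (ρY.restrictField K') (restrictIntertwining ρX ρY i))
      (toTopRepHom (ρY.restrictField K') (ρZ.restrictField K') (restrictIntertwining ρY ρZ p)) where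
  comp_eq_zero := by
    apply TopRep.hom_ext
    rw [TopRep.hom_comp, TopRep.hom_zero]
    exact DFunLike.ext _ _ fun x => hS.g_f_apply x
  injective := hS.injective
  exact_mid := hS.exact_mid
  surjective := hS.surjective

/-! ## §3 The local readout is onto -/

variable [Module.Finite ℤ X] [Module.Finite ℤ VP] [Module.Finite ℤ Z] [CharZero K']
  [FiniteDimensional K' (localLayer K K' L)] [Normal K' (localLayer K K' L)]

/-- **Every class of `H¹(K', Hom(N, K̄'ˣ))` is the readout `δ₀ h` of a `Γ_{K'}`-equivariant `h : N₁ → K̄'ˣ`**, for a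
presentation `0 → N₁ → P → N → 0` of discrete `Γ_K`-modules with `P` a permutation module whose basis has
uniform open isotropy `Γ_L`, restricted along `Γ_{K'} → Γ_K` (characteristic `0`; `K'(ιL)/K'` finite normal).
[cite: MilneADT2006, I Lemma 4.13 (proof)][cite: SerreLocalFields1979, X §1 Prop. 2] -/
theorem dualδ₀_units_restrict_surjective (hstab : UniformIsotropy K β L) (he : PermutedBasis K ρP e)
    {i : ρX.toContRepresentation →ⁱL ρP.toContRepresentation}
    {p : ρP.toContRepresentation →ⁱL ρZ.toContRepresentation}
    (hS : IsSES (toTopRepHom ρX ρP i) (toTopRepHom ρP ρZ p)) :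
    Function.Surjective (dualδ₀ (ρX.restrictField K') (ρP.restrictField K') (ρZ.restrictField K') (units K')
      (restrictIntertwining ρX ρP i) (restrictIntertwining ρP ρZ p) (isSES_restrict ρX ρP ρZ hS)
      (haveI := divisibleByUnitsCarrier K'; baer_of_divisibleBy (UnitsCarrier K'))) := by
  letI := resAction K K' β
  exact dualδ₀_surjective _ _ _ _ _ _ _ _
    (galoisCohomology_hom_units_eq_zero (uniformIsotropy_restrict hstab) (permutedBasis_restrict he))

end HomDual

end Literature.NumberTheory.GaloisRepresentations

end
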